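import Summits.Ventures.PercRepro.C041TriangleMarkedExit
import Summits.Ventures.PercRepro.C041TriangleLeafStar2Mark
import Summits.Ventures.PercRepro.C041TriangleStar2LeafMark
import Summits.Ventures.PercRepro.C041TriangleLeafMarkLeafMark
import Summits.Ventures.PercRepro.C041TriangleLeafMarkLeafMark0
import Summits.Ventures.PercRepro.C041TriangleLeafMarkStar2Mark
import Summits.Ventures.PercRepro.C041TriangleLeafMarkStar2Mark0

/-!
# THE TRIANGLE ON EVERY PAIR OF STARS WITH ≤ 1 AND ≤ 2 INTERIOR LEAVES AND ARBITRARY MARKS (mine-3, gen 67;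
C-041.md §21 (bf))

`InCone_thetaTri_marks_of_seeds_pair` (NINE SEEDS GIVE ALL MARKS): for cone elements `w, w′`, if the nine triangles
`θ_△(w·μ, w′·μ′)` with `μ, μ′ ∈ {1, v 1, v 0}` are cone elements, then so is `θ_△(w·X(p,q), w′·X(p′,q′))` for all
`p, q, p′, q′ ≥ 0` — both mark types at an exit are free (`InCone_thetaTri_mul_marks`), and one-type marks are free
after the first (`InCone_thetaTri_mul_pow_v_one_of`, `…_zero_of`), on either side by `thetaTri_comm`.  The seeds for
`w = v a`, `w′ = v b` and for `w = v a`, `w′ = v b * v c` are the leaf × leaf theorem, THEOREM (LEAF × TWO-LEAF STAR) and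
the six kit-LP certificates of this gen (`C041TriangleLeafStar2Mark`, `…Star2LeafMark`, `…LeafMarkLeafMark`,
`…LeafMarkLeafMark0`, `…LeafMarkStar2Mark`, `…LeafMarkStar2Mark0`) with their mirrors under the type-swap involution
`sw` (`InCone_thetaTri_sw_iff`).  THEOREMS: `InCone_thetaTri_leafMarks_leafMarks` — `θ_△(v a·X(p,q), v b·X(p′,q′)) ∈ cone`;
`InCone_thetaTri_leafMarks_star2Marks` — `θ_△(v a·X(p,q), v b·v c·X(p′,q′)) ∈ cone`; `InCone_thetaTri_leaf_star2_marks` —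
`θ_△(v c, v a·v b·X(p,q)) ∈ cone`: with (bb) (every marked vertex against every star) the triangle is settled on every
pair of stars with at most one and at most two INTERIOR leaves, whatever the marks.
-/

namespace PercRepro

namespace RelaxedTriangle

open TreeClosure

/-! ## Mirror tools -/

/-- `sw` commutes with powers. -/
theorem sw_pow (w : Vec6) (n : ℕ) : sw (w ^ n) = sw w ^ n := by
  induction n with
  | zero => simp [sw_one]
  | succ n ih => rw [pow_succ, sw_mul, ih, pow_succ]

/-- The mirror of a marked vertex: `sw X(p,q) = X(q,p)`. -/
theorem sw_marks (p q : ℕ) : sw (v 1 ^ p * v 0 ^ q) = v 1 ^ q * v 0 ^ p := by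
  rw [sw_mul, sw_pow, sw_pow, sw_v, sw_v]
  norm_num [mul_comm]

/-- Cone membership of a triangle is mirror-invariant. -/
theorem InCone_thetaTri_sw_iff (w w' : Vec6) :
    InCone (thetaTri (sw w) (sw w')) ↔ InCone (thetaTri w w') := by
  rw [thetaTri_sw]
  constructor
  · intro h
    have := InCone_sw h
    rwa [sw_sw] at this
  · exact InCone_sw

/-! ## Nine seeds give all marks -/

/-- One-type marks on the FIRST exit are free after the first. -/
theorem InCone_thetaTri_pow_v_one_mul_of {w w' : Vec6} (hw : InCone w) (hw' : InCone w')
    (h : InCone (thetaTri (w * v 1) w')) (p : ℕ) (hp : 1 ≤ p) : InCone (thetaTri (w * v 1 ^ p) w') := by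
  rw [thetaTri_comm]
  exact InCone_thetaTri_mul_pow_v_one_of hw' hw (by rwa [thetaTri_comm]) p hp

/-- The mirror. -/
theorem InCone_thetaTri_pow_v_zero_mul_of {w w' : Vec6} (hw : InCone w) (hw' : InCone w')
    (h : InCone (thetaTri (w * v 0) w')) (q : ℕ) (hq : 1 ≤ q) : InCone (thetaTri (w * v 0 ^ q) w') := by
  rw [thetaTri_comm]
  exact InCone_thetaTri_mul_pow_v_zero_of hw' hw (by rwa [thetaTri_comm]) q hq

/-- **NINE SEEDS GIVE ALL MARKS**: if `θ_△(w·μ, w′·μ′) ∈ cone` for `μ, μ′ ∈ {1, v 1, v 0}`, then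
`θ_△(w·X(p,q), w′·X(p′,q′)) ∈ cone` for all `p, q, p′, q′`. -/
theorem InCone_thetaTri_marks_of_seeds_pair {w w' : Vec6} (hw : InCone w) (hw' : InCone w')
    (h00 : InCone (thetaTri w w'))
    (hA1 : InCone (thetaTri w (w' * v 1))) (hA0 : InCone (thetaTri w (w' * v 0)))
    (hB1 : InCone (thetaTri (w * v 1) w')) (hB0 : InCone (thetaTri (w * v 0) w'))
    (h11 : InCone (thetaTri (w * v 1) (w' * v 1))) (h10 : InCone (thetaTri (w * v 1) (w' * v 0)))
    (h01 : InCone (thetaTri (w * v 0) (w' * v 1))) (h00' : InCone (thetaTri (w * v 0) (w' * v 0)))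
    (p q p' q' : ℕ) : InCone (thetaTri (w * (v 1 ^ p * v 0 ^ q)) (w' * (v 1 ^ p' * v 0 ^ q'))) := by
  have hwm : InCone (w * (v 1 ^ p * v 0 ^ q)) :=
    hw.mul ((InCone_pow_v_one p).mul (InCone_pow_v_zero q))
  have hw'm : InCone (w' * (v 1 ^ p' * v 0 ^ q')) :=
    hw'.mul ((InCone_pow_v_one p').mul (InCone_pow_v_zero q'))
  -- both mark types on the second exit: free
  by_cases hpq' : 1 ≤ p' ∧ 1 ≤ q'
  · exact InCone_thetaTri_mul_marks hwm hw' p' q' hpq'.1 hpq'.2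
  -- both mark types on the first exit: free
  by_cases hpq : 1 ≤ p ∧ 1 ≤ q
  · rw [thetaTri_comm]
    exact InCone_thetaTri_mul_marks hw'm hw p q hpq.1 hpq.2
  -- the one-type cases: reduce the second exit first, then the first exit
  have key : ∀ (u : Vec6), InCone u → InCone (thetaTri u w') → InCone (thetaTri u (w' * v 1)) →
      InCone (thetaTri u (w' * v 0)) → InCone (thetaTri u (w' * (v 1 ^ p' * v 0 ^ q'))) := by
    intro u hu g0 g1 g2
    rcases Nat.eq_zero_or_pos p' with hp' | hp'
    · subst hp'
      rcases Nat.eq_zero_or_pos q' with hq' | hq'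
      · subst hq'; simpa using g0
      · simp only [pow_zero, one_mul]
        exact InCone_thetaTri_mul_pow_v_zero_of hu hw' g2 q' hq'
    · have hq' : q' = 0 := by
        by_contra hne
        exact hpq' ⟨hp', Nat.one_le_iff_ne_zero.mpr hne⟩
      subst hq'
      simp only [pow_zero, mul_one]
      exact InCone_thetaTri_mul_pow_v_one_of hu hw' g1 p' hp'
  rcases Nat.eq_zero_or_pos p with hp | hp
  · subst hp
    rcases Nat.eq_zero_or_pos q with hq | hq
    · subst hq
      simp only [pow_zero, mul_one]
      exact key w hw h00 hA1 hA0
    · simp only [pow_zero, one_mul]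
      refine key (w * v 0 ^ q) (hw.mul (InCone_pow_v_zero q)) ?_ ?_ ?_
      · exact InCone_thetaTri_pow_v_zero_mul_of hw hw' hB0 q hq
      · exact InCone_thetaTri_pow_v_zero_mul_of hw (hw'.mul InCone_v1) h01 q hq
      · exact InCone_thetaTri_pow_v_zero_mul_of hw (hw'.mul InCone_v0) h00' q hq
  · have hq : q = 0 := by
      by_contra hne
      exact hpq ⟨hp, Nat.one_le_iff_ne_zero.mpr hne⟩
    subst hq
    simp only [pow_zero, mul_one]
    refine key (w * v 1 ^ p) (hw.mul (InCone_pow_v_one p)) ?_ ?_ ?_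
    · exact InCone_thetaTri_pow_v_one_mul_of hw hw' hB1 p hp
    · exact InCone_thetaTri_pow_v_one_mul_of hw (hw'.mul InCone_v1) h11 p hp
    · exact InCone_thetaTri_pow_v_one_mul_of hw (hw'.mul InCone_v0) h10 p hp

/-! ## The seeds for a leaf against a leaf, and for a leaf against a two-leaf star -/

/-- The mirror of THEOREM (LEAF × TWO LEAVES + MARK): the 2-mark. -/
theorem InCone_thetaTri_leafStar2Mark0 (a b c : ℝ) (ha : 0 ≤ a ∧ a ≤ 1) (hb : 0 ≤ b ∧ b ≤ 1) (hc : 0 ≤ c ∧ c ≤ 1) :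
    InCone (thetaTri (v c) (v a * v b * v 0)) := by
  have h := InCone_thetaTri_leafStar2Mark (1 - a) (1 - b) (1 - c) ⟨by linarith [ha.2], by linarith [ha.1]⟩
    ⟨by linarith [hb.2], by linarith [hb.1]⟩ ⟨by linarith [hc.2], by linarith [hc.1]⟩
  rw [← InCone_thetaTri_sw_iff] at h
  simp only [sw_mul, sw_v] at h
  simpa using h

/-- The mirror of THEOREM (TWO-LEAF STAR × LEAF + MARK): the 2-mark. -/
theorem InCone_thetaTri_star2LeafMark0 (a b c : ℝ) (ha : 0 ≤ a ∧ a ≤ 1) (hb : 0 ≤ b ∧ b ≤ 1) (hc : 0 ≤ c ∧ c ≤ 1) :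
    InCone (thetaTri (v a * v b) (v c * v 0)) := by
  have h := InCone_thetaTri_star2LeafMark (1 - a) (1 - b) (1 - c) ⟨by linarith [ha.2], by linarith [ha.1]⟩
    ⟨by linarith [hb.2], by linarith [hb.1]⟩ ⟨by linarith [hc.2], by linarith [hc.1]⟩
  rw [← InCone_thetaTri_sw_iff] at h
  simp only [sw_mul, sw_v] at h
  simpa using h

/-- The mirror of THEOREM (LEAF + MARK × LEAF + MARK): two 2-marks. -/
theorem InCone_thetaTri_leafMark0LeafMark0 (a b : ℝ) (ha : 0 ≤ a ∧ a ≤ 1) (hb : 0 ≤ b ∧ b ≤ 1) :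
    InCone (thetaTri (v a * v 0) (v b * v 0)) := by
  have h := InCone_thetaTri_leafMarkLeafMark (1 - a) (1 - b) ⟨by linarith [ha.2], by linarith [ha.1]⟩
    ⟨by linarith [hb.2], by linarith [hb.1]⟩
  rw [← InCone_thetaTri_sw_iff] at h
  simp only [sw_mul, sw_v] at h
  simpa using h

/-- The mirror of THEOREM (LEAF + MARK × TWO LEAVES + MARK): two 2-marks. -/
theorem InCone_thetaTri_leafMark0Star2Mark0 (a b c : ℝ) (ha : 0 ≤ a ∧ a ≤ 1) (hb : 0 ≤ b ∧ b ≤ 1)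
    (hc : 0 ≤ c ∧ c ≤ 1) : InCone (thetaTri (v a * v 0) (v b * v c * v 0)) := by
  have h := InCone_thetaTri_leafMarkStar2Mark (1 - a) (1 - b) (1 - c) ⟨by linarith [ha.2], by linarith [ha.1]⟩
    ⟨by linarith [hb.2], by linarith [hb.1]⟩ ⟨by linarith [hc.2], by linarith [hc.1]⟩
  rw [← InCone_thetaTri_sw_iff] at h
  simp only [sw_mul, sw_v] at h
  simpa using h

/-- The mirror of THEOREM (LEAF + 1-MARK × TWO LEAVES + 2-MARK): a 2-mark against a 1-mark. -/
theorem InCone_thetaTri_leafMark0Star2Mark (a b c : ℝ) (ha : 0 ≤ a ∧ a ≤ 1) (hb : 0 ≤ b ∧ b ≤ 1)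
    (hc : 0 ≤ c ∧ c ≤ 1) : InCone (thetaTri (v a * v 0) (v b * v c * v 1)) := by
  have h := InCone_thetaTri_leafMarkStar2Mark0 (1 - a) (1 - b) (1 - c) ⟨by linarith [ha.2], by linarith [ha.1]⟩
    ⟨by linarith [hb.2], by linarith [hb.1]⟩ ⟨by linarith [hc.2], by linarith [hc.1]⟩
  rw [← InCone_thetaTri_sw_iff] at h
  simp only [sw_mul, sw_v] at h
  simpa using h

/-! ## The theorems -/

/-- **THEOREM (TWO LEAVES WITH ANY MARKS)**: `θ_△(v a · X(p,q), v b · X(p′,q′)) ∈ cone` for all marks. -/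
theorem InCone_thetaTri_leafMarks_leafMarks (a b : ℝ) (ha : 0 ≤ a ∧ a ≤ 1) (hb : 0 ≤ b ∧ b ≤ 1) (p q p' q' : ℕ) :
    InCone (thetaTri (v a * (v 1 ^ p * v 0 ^ q)) (v b * (v 1 ^ p' * v 0 ^ q'))) := by
  refine InCone_thetaTri_marks_of_seeds_pair (InCone_v a ha) (InCone_v b hb) (thetaTri_v_InCone a b ha hb)
    (InCone_thetaTri_leaf_star2 b 1 a hb ⟨zero_le_one, le_rfl⟩ ha)
    (InCone_thetaTri_leaf_star2 b 0 a hb ⟨le_rfl, zero_le_one⟩ ha) ?_ ?_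
    (InCone_thetaTri_leafMarkLeafMark a b ha hb) (InCone_thetaTri_leafMarkLeafMark0 a b ha hb) ?_
    (InCone_thetaTri_leafMark0LeafMark0 a b ha hb) p q p' q'
  · rw [thetaTri_comm]; exact InCone_thetaTri_leaf_star2 a 1 b ha ⟨zero_le_one, le_rfl⟩ hb
  · rw [thetaTri_comm]; exact InCone_thetaTri_leaf_star2 a 0 b ha ⟨le_rfl, zero_le_one⟩ hb
  · rw [thetaTri_comm]; exact InCone_thetaTri_leafMarkLeafMark0 b a hb ha

/-- **THEOREM (A LEAF AND A TWO-LEAF STAR WITH ANY MARKS)**: `θ_△(v a · X(p,q), v b · v c · X(p′,q′)) ∈ cone`. -/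
theorem InCone_thetaTri_leafMarks_star2Marks (a b c : ℝ) (ha : 0 ≤ a ∧ a ≤ 1) (hb : 0 ≤ b ∧ b ≤ 1)
    (hc : 0 ≤ c ∧ c ≤ 1) (p q p' q' : ℕ) :
    InCone (thetaTri (v a * (v 1 ^ p * v 0 ^ q)) (v b * v c * (v 1 ^ p' * v 0 ^ q'))) := by
  refine InCone_thetaTri_marks_of_seeds_pair (InCone_v a ha) ((InCone_v b hb).mul (InCone_v c hc))
    (InCone_thetaTri_leaf_star2 b c a hb hc ha) (InCone_thetaTri_leafStar2Mark b c a hb hc ha)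
    (InCone_thetaTri_leafStar2Mark0 b c a hb hc ha) ?_ ?_
    (InCone_thetaTri_leafMarkStar2Mark a b c ha hb hc) (InCone_thetaTri_leafMarkStar2Mark0 a b c ha hb hc)
    (InCone_thetaTri_leafMark0Star2Mark a b c ha hb hc) (InCone_thetaTri_leafMark0Star2Mark0 a b c ha hb hc) p q p' q'
  · rw [thetaTri_comm]; exact InCone_thetaTri_star2LeafMark b c a hb hc ha
  · rw [thetaTri_comm]; exact InCone_thetaTri_star2LeafMark0 b c a hb hc ha

/-- **THEOREM (LEAF × TWO LEAVES WITH ANY MARKS)**: `θ_△(v c, v a · v b · X(p,q)) ∈ cone` for all `p, q`. -/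
theorem InCone_thetaTri_leaf_star2_marks (a b c : ℝ) (ha : 0 ≤ a ∧ a ≤ 1) (hb : 0 ≤ b ∧ b ≤ 1) (hc : 0 ≤ c ∧ c ≤ 1)
    (p q : ℕ) : InCone (thetaTri (v c) (v a * v b * (v 1 ^ p * v 0 ^ q))) := by
  have h := InCone_thetaTri_leafMarks_star2Marks c a b hc ha hb 0 0 p q
  simpa using h

end RelaxedTriangle

end PercRepro
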